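import Literature.NumberTheory.LFunctions.DirichletPolynomialDiscreteMeanValue
import Literature.NumberTheory.LFunctions.SoundZeroWindowSums
import HarnessLib

/-!
# Sums over zeros of `ζ` of values of an analytic function, by Sobolev's inequality

Topic `Literature/NumberTheory/LFunctions`. A standard device for bounding
`∑_{T < γ ≤ T'} m(ρ) |F(ρ)|` over the zeros `ρ = β + iγ` of `ζ` (counted with multiplicity,
ANY real part `0 ≤ β ≤ 1`) when `F` is analytic and only mean values of `F` on horizontal /
vertical lines are available (Gallagher's Sobolev inequality in two variables, as used e.g. in
Montgomery, *Topics in Multiplicative Number Theory*, Ch. 9–12, and Ivić 1985 §5, (5.15)–(5.16)):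

* `Literature.NumberTheory.LFunctions.norm_le_integral_add_integral_deriv_of_mem_Icc` — the
  one-variable Sobolev inequality on a unit interval `[a, a+1] ∋ x`:
  `|f(x)| ≤ ∫_a^{a+1} |f| + ∫_a^{a+1} |f'|`;
* `Literature.NumberTheory.LFunctions.norm_le_strip_integral` — the two-variable form on the
  unit square `[0,1] × [a, a+1] ∋ (Re ρ, Im ρ)`:
  `|F(ρ)| ≤ ∫_0^1 ∫_a^{a+1} (|F| + 2|F'| + |F''|)(σ + it) dt dσ`;
* `Literature.NumberTheory.LFunctions.sum_zerosBetween_windows_le` — grouping the zeros with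
  `T < γ ≤ T + K` into unit windows with the local count `N(a+1) - N(a) ≤ A log(a+2)`;
* `Literature.NumberTheory.LFunctions.sum_zerosBetween_norm_le_strip_integral` — the
  combination: `∑_{T < γ ≤ T+K} m(ρ)|F(ρ)| ≤ A log(T+K+2) ∫_0^1 ∫_T^{T+K} (|F| + 2|F'| + |F''|)`.

Everything is proved; there are no named facts.

## References

* A. Ivić, *The Riemann Zeta-Function* (1985), (5.15)–(5.16) (Gallagher's inequality).
* E. C. Titchmarsh, *The Theory of the Riemann Zeta-Function*, 2nd ed. (1986), Thm. 9.2
  (`N(T+1) - N(T) = O(log T)`).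
-/

noncomputable section

open Complex MeasureTheory Set Filter Finset intervalIntegral
open scoped Real Topology

namespace Literature.NumberTheory.LFunctions

/-! ## Sobolev's inequality on a unit interval and on a unit square -/

/-- **Sobolev's inequality on a unit interval**: if `f : ℝ → ℂ` has the continuous derivative
`f'` everywhere and `x ∈ [a, a+1]`, then `‖f x‖ ≤ ∫_a^{a+1} ‖f‖ + ∫_a^{a+1} ‖f'‖`.
[cite: Ivic1985, (5.15)–(5.16)] -/
theorem norm_le_integral_add_integral_deriv_of_mem_Icc {f f' : ℝ → ℂ}
    (hf : ∀ u, HasDerivAt f (f' u) u) (hf' : Continuous f') {a x : ℝ}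
    (hx : x ∈ Set.Icc a (a + 1)) :
    ‖f x‖ ≤ (∫ u in a..(a + 1), ‖f u‖) + ∫ u in a..(a + 1), ‖f' u‖ := by
  have hfc : Continuous f := continuous_iff_continuousAt.2 fun u ↦ (hf u).continuousAt
  set K : ℝ := ∫ u in a..(a + 1), ‖f' u‖ with hK
  have hab : a ≤ a + 1 := by linarith
  have hpt : ∀ u ∈ Set.Icc a (a + 1), ‖f x‖ ≤ ‖f u‖ + K := by
    intro u hu
    have hFTC : ∫ v in u..x, f' v = f x - f u :=
      integral_eq_sub_of_hasDerivAt (fun v _ ↦ hf v) (hf'.intervalIntegrable _ _)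
    have h1 : ‖f x - f u‖ ≤ K := by
      rw [← hFTC]
      calc ‖∫ v in u..x, f' v‖ ≤ |∫ v in u..x, ‖f' v‖| :=
            norm_integral_le_abs_integral_norm
        _ ≤ K := by
          rw [hK]
          rcases le_total u x with hux | hux
          · rw [abs_of_nonneg (integral_nonneg hux fun v _ ↦ norm_nonneg _)]
            exact integral_mono_interval hu.1 hux hx.2
              (Filter.Eventually.of_forall fun v ↦ norm_nonneg _)
              (hf'.norm.intervalIntegrable _ _)
          · rw [integral_symm, abs_neg,
              abs_of_nonneg (integral_nonneg hux fun v _ ↦ norm_nonneg _)]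
            exact integral_mono_interval hx.1 hux hu.2
              (Filter.Eventually.of_forall fun v ↦ norm_nonneg _)
              (hf'.norm.intervalIntegrable _ _)
    calc ‖f x‖ = ‖f u + (f x - f u)‖ := by ring_nf
      _ ≤ ‖f u‖ + ‖f x - f u‖ := norm_add_le _ _
      _ ≤ ‖f u‖ + K := by linarith
  have hint : ∫ u in a..(a + 1), ‖f x‖ ≤ ∫ u in a..(a + 1), (‖f u‖ + K) :=
    integral_mono_on hab intervalIntegrable_const
      ((hfc.norm.add continuous_const).intervalIntegrable _ _) hpt
  rw [intervalIntegral.integral_const, intervalIntegral.integral_add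
    (hfc.norm.intervalIntegrable _ _) intervalIntegrable_const,
    intervalIntegral.integral_const] at hint
  simp only [add_sub_cancel_left, smul_eq_mul, one_mul] at hint
  linarith

/-- Restriction of an analytic `F` to a horizontal line `σ ↦ F(σ + ic)`: derivative `F'`.
[folklore] -/
theorem hasDerivAt_comp_add_const_ofReal {F F₁ : ℂ → ℂ} (hF : ∀ s, HasDerivAt F (F₁ s) s)
    (c : ℂ) (σ : ℝ) :
    HasDerivAt (fun y : ℝ ↦ F (y + c)) (F₁ (σ + c)) σ := by
  have h : HasDerivAt (fun w : ℂ ↦ F (w + c)) (F₁ (σ + c) * 1) (σ : ℂ) :=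
    (hF ((σ : ℂ) + c)).comp (σ : ℂ) ((hasDerivAt_id (σ : ℂ)).add_const c)
  rw [mul_one] at h
  exact h.comp_ofReal

/-- Restriction of an analytic `F` to a vertical line `t ↦ F(σ + it)`: derivative `i F'`.
[folklore] -/
theorem hasDerivAt_comp_const_add_mul_I {F F₁ : ℂ → ℂ} (hF : ∀ s, HasDerivAt F (F₁ s) s)
    (σ : ℂ) (t : ℝ) :
    HasDerivAt (fun y : ℝ ↦ F (σ + y * I)) (F₁ (σ + t * I) * I) t := by
  have h : HasDerivAt (fun w : ℂ ↦ F (σ + w * I)) (F₁ (σ + t * I) * (1 * I)) (t : ℂ) :=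
    (hF (σ + (t : ℂ) * I)).comp (t : ℂ) (((hasDerivAt_id (t : ℂ)).mul_const I).const_add σ)
  rw [one_mul] at h
  exact h.comp_ofReal

/-- The vertical Sobolev step: `‖F(σ + iγ)‖ ≤ ∫_a^{a+1} ‖F(σ+it)‖ dt + ∫_a^{a+1} ‖F'(σ+it)‖ dt`
for `γ ∈ [a, a+1]`. [cite: Ivic1985, (5.15)–(5.16)] -/
theorem norm_le_integral_vertical {F F₁ : ℂ → ℂ} (hF : ∀ s, HasDerivAt F (F₁ s) s)
    (hF₁ : Continuous F₁) (σ : ℂ) {a γ : ℝ} (hγ : γ ∈ Set.Icc a (a + 1)) :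
    ‖F (σ + γ * I)‖ ≤ (∫ t in a..(a + 1), ‖F (σ + t * I)‖)
      + ∫ t in a..(a + 1), ‖F₁ (σ + t * I)‖ := by
  have h := norm_le_integral_add_integral_deriv_of_mem_Icc
    (f := fun y : ℝ ↦ F (σ + y * I)) (f' := fun y : ℝ ↦ F₁ (σ + y * I) * I)
    (fun t ↦ hasDerivAt_comp_const_add_mul_I hF σ t) (by fun_prop) hγ
  have e : ∫ t in a..(a + 1), ‖F₁ (σ + t * I) * I‖ = ∫ t in a..(a + 1), ‖F₁ (σ + t * I)‖ := by
    refine intervalIntegral.integral_congr fun t _ ↦ ?_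
    simp
  rw [e] at h
  exact h

/-- **Sobolev's inequality on a unit square**: if `F` is entire with `F' = F₁`, `F₁' = F₂`
(`F₂` continuous), `0 ≤ Re ρ ≤ 1` and `a ≤ Im ρ ≤ a + 1`, then
`‖F ρ‖ ≤ ∫_0^1 ∫_a^{a+1} ‖F‖ + 2 ∫_0^1 ∫_a^{a+1} ‖F'‖ + ∫_0^1 ∫_a^{a+1} ‖F''‖`, the integrands
evaluated at `σ + it`. [cite: Ivic1985, (5.15)–(5.16)] -/
theorem norm_le_strip_integral {F F₁ F₂ : ℂ → ℂ} (hF : ∀ s, HasDerivAt F (F₁ s) s)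
    (hF₁ : ∀ s, HasDerivAt F₁ (F₂ s) s) (hF₂ : Continuous F₂) {a : ℝ} {ρ : ℂ}
    (hre0 : 0 ≤ ρ.re) (hre1 : ρ.re ≤ 1) (him0 : a ≤ ρ.im) (him1 : ρ.im ≤ a + 1) :
    ‖F ρ‖ ≤ (∫ σ in (0 : ℝ)..1, ∫ t in a..(a + 1), ‖F (σ + t * I)‖)
      + 2 * (∫ σ in (0 : ℝ)..1, ∫ t in a..(a + 1), ‖F₁ (σ + t * I)‖)
      + ∫ σ in (0 : ℝ)..1, ∫ t in a..(a + 1), ‖F₂ (σ + t * I)‖ := by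
  have hFc : Continuous F := continuous_iff_continuousAt.2 fun s ↦ (hF s).continuousAt
  have hF₁c : Continuous F₁ := continuous_iff_continuousAt.2 fun s ↦ (hF₁ s).continuousAt
  -- horizontal step at height `γ = Im ρ`
  have hρ : ((ρ.re : ℝ) : ℂ) + (ρ.im : ℂ) * I = ρ := Complex.re_add_im ρ
  have h1 := norm_le_integral_add_integral_deriv_of_mem_Icc
    (f := fun y : ℝ ↦ F (y + ρ.im * I)) (f' := fun y : ℝ ↦ F₁ (y + ρ.im * I))
    (fun σ ↦ hasDerivAt_comp_add_const_ofReal hF _ σ) (by fun_prop) (a := 0) (x := ρ.re)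
    ⟨hre0, by simpa using hre1⟩
  simp only [hρ, zero_add] at h1
  -- vertical steps, pointwise in `σ`
  have hγ : ρ.im ∈ Set.Icc a (a + 1) := ⟨him0, him1⟩
  have hv0 : ∀ σ ∈ Set.Icc (0 : ℝ) 1, ‖F (σ + ρ.im * I)‖ ≤
      (∫ t in a..(a + 1), ‖F (σ + t * I)‖) + ∫ t in a..(a + 1), ‖F₁ (σ + t * I)‖ :=
    fun σ _ ↦ norm_le_integral_vertical hF hF₁c σ hγ
  have hv1 : ∀ σ ∈ Set.Icc (0 : ℝ) 1, ‖F₁ (σ + ρ.im * I)‖ ≤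
      (∫ t in a..(a + 1), ‖F₁ (σ + t * I)‖) + ∫ t in a..(a + 1), ‖F₂ (σ + t * I)‖ :=
    fun σ _ ↦ norm_le_integral_vertical hF₁ hF₂ σ hγ
  -- continuity of the parametric integrals
  have hc0 : Continuous fun σ : ℝ ↦ ∫ t in a..(a + 1), ‖F (σ + t * I)‖ :=
    intervalIntegral.continuous_parametric_intervalIntegral_of_continuous' (by fun_prop) _ _
  have hc1 : Continuous fun σ : ℝ ↦ ∫ t in a..(a + 1), ‖F₁ (σ + t * I)‖ :=
    intervalIntegral.continuous_parametric_intervalIntegral_of_continuous' (by fun_prop) _ _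
  have hc2 : Continuous fun σ : ℝ ↦ ∫ t in a..(a + 1), ‖F₂ (σ + t * I)‖ :=
    intervalIntegral.continuous_parametric_intervalIntegral_of_continuous' (by fun_prop) _ _
  have hI0 : ∫ σ in (0 : ℝ)..1, ‖F (σ + ρ.im * I)‖ ≤
      ∫ σ in (0 : ℝ)..1, ((∫ t in a..(a + 1), ‖F (σ + t * I)‖)
        + ∫ t in a..(a + 1), ‖F₁ (σ + t * I)‖) :=
    integral_mono_on zero_le_one ((hFc.comp (by fun_prop)).norm.intervalIntegrable _ _)
      ((hc0.add hc1).intervalIntegrable _ _) hv0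
  have hI1 : ∫ σ in (0 : ℝ)..1, ‖F₁ (σ + ρ.im * I)‖ ≤
      ∫ σ in (0 : ℝ)..1, ((∫ t in a..(a + 1), ‖F₁ (σ + t * I)‖)
        + ∫ t in a..(a + 1), ‖F₂ (σ + t * I)‖) :=
    integral_mono_on zero_le_one ((hF₁c.comp (by fun_prop)).norm.intervalIntegrable _ _)
      ((hc1.add hc2).intervalIntegrable _ _) hv1
  rw [intervalIntegral.integral_add (hc0.intervalIntegrable _ _) (hc1.intervalIntegrable _ _)]
    at hI0
  rw [intervalIntegral.integral_add (hc1.intervalIntegrable _ _) (hc2.intervalIntegrable _ _)]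
    at hI1
  linarith

/-! ## Grouping the zeros into unit windows -/

/-- One window: if `φ ≤ W` on `zerosBetween a b` (`0 ≤ a ≤ b`) then
`∑_{a < Im ρ ≤ b} m(ρ) φ(ρ) ≤ W (N(b) - N(a))`. [folklore] -/
theorem sum_zerosBetween_mul_le_count {a b : ℝ} (h0 : 0 ≤ a) (hab : a ≤ b) {φ : ℂ → ℝ}
    {W : ℝ} (hφ : ∀ ρ ∈ SchoenfeldBound.zerosBetween a b, φ ρ ≤ W) :
    ∑ ρ ∈ SchoenfeldBound.zerosBetween a b, (riemannZetaZeroOrder ρ : ℝ) * φ ρ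
      ≤ W * ((zetaZeroCount b : ℝ) - zetaZeroCount a) := by
  rw [SchoenfeldBound.zetaZeroCount_sub_eq_sum hab, Finset.mul_sum]
  refine Finset.sum_le_sum fun ρ hρ ↦ ?_
  rw [mul_comm W]
  exact mul_le_mul_of_nonneg_left (hφ ρ hρ)
    (SchoenfeldBound.zeroOrder_nonneg_of_mem_zerosBetween h0 hρ)

/-- **Grouping into unit windows**: if `φ(ρ) ≤ W_n` for the zeros with `n < Im ρ ≤ n + 1`
(`T ≤ n < T + K`, `W_n ≥ 0`) and `N(a+1) - N(a) ≤ A log(a+2)` (`a ≥ 0`, `A ≥ 0`), then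
`∑_{T < Im ρ ≤ T+K} m(ρ) φ(ρ) ≤ A log(T+K+2) ∑_{T ≤ n < T+K} W_n`.
[cite: Titchmarsh1986, Thm. 9.2] -/
theorem sum_zerosBetween_windows_le {φ : ℂ → ℝ} {T : ℕ} {W : ℕ → ℝ} (hW0 : ∀ n, 0 ≤ W n)
    {A : ℝ} (hA0 : 0 ≤ A)
    (hA : ∀ a : ℝ, 0 ≤ a → (zetaZeroCount (a + 1) : ℝ) - zetaZeroCount a ≤ A * Real.log (a + 2)) :
    ∀ K : ℕ, (∀ n ∈ Finset.Ico T (T + K),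
        ∀ ρ ∈ SchoenfeldBound.zerosBetween (n : ℝ) ((n : ℝ) + 1), φ ρ ≤ W n) →
      ∑ ρ ∈ SchoenfeldBound.zerosBetween (T : ℝ) ((T + K : ℕ) : ℝ),
          (riemannZetaZeroOrder ρ : ℝ) * φ ρ
        ≤ A * Real.log ((T + K : ℕ) + 2) * ∑ n ∈ Finset.Ico T (T + K), W n := by
  intro K
  induction K with
  | zero =>
    intro _
    have he : SchoenfeldBound.zerosBetween (T : ℝ) (T : ℝ) = ∅ := by
      ext ρ
      simp only [Finset.notMem_empty, iff_false]
      intro h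
      obtain ⟨-, -, -, h3, h4⟩ := (SchoenfeldBound.mem_zerosBetween (Nat.cast_nonneg T)).1 h
      linarith
    simp [he]
  | succ K ih =>
    intro hφ
    have hT0 : (0 : ℝ) ≤ T := Nat.cast_nonneg T
    have h1 : (T : ℝ) ≤ ((T + K : ℕ) : ℝ) := by exact_mod_cast Nat.le_add_right T K
    have h2 : ((T + K : ℕ) : ℝ) ≤ ((T + (K + 1) : ℕ) : ℝ) := by push_cast; linarith
    rw [SoundTest.sum_zerosBetween_split hT0 h1 h2]
    have ih' := ih fun n hn ρ hρ ↦ hφ n (Finset.mem_Ico.2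
      ⟨(Finset.mem_Ico.1 hn).1, by have := (Finset.mem_Ico.1 hn).2; omega⟩) ρ hρ
    -- the last window
    have hTK0 : (0 : ℝ) ≤ ((T + K : ℕ) : ℝ) := Nat.cast_nonneg _
    have hlast : ∑ ρ ∈ SchoenfeldBound.zerosBetween ((T + K : ℕ) : ℝ) ((T + (K + 1) : ℕ) : ℝ),
        (riemannZetaZeroOrder ρ : ℝ) * φ ρ ≤ W (T + K) * (A * Real.log ((T + K : ℕ) + 2)) := by
      have e : ((T + (K + 1) : ℕ) : ℝ) = ((T + K : ℕ) : ℝ) + 1 := by push_cast; ring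
      rw [e]
      refine (sum_zerosBetween_mul_le_count (W := W (T + K)) hTK0 (by linarith) fun ρ hρ ↦ ?_).trans ?_
      · exact hφ (T + K) (Finset.mem_Ico.2 ⟨by omega, by omega⟩) ρ (by exact_mod_cast hρ)
      · exact mul_le_mul_of_nonneg_left (hA _ hTK0) (hW0 _)
    -- monotonicity of the logarithm
    have hlog : Real.log (((T + K : ℕ) : ℝ) + 2) ≤ Real.log (((T + (K + 1) : ℕ) : ℝ) + 2) :=
      Real.log_le_log (by positivity) (by push_cast; linarith)
    have hlog0 : 0 ≤ Real.log (((T + K : ℕ) : ℝ) + 2) := Real.log_nonneg (by linarith)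
    have hsumW : 0 ≤ ∑ n ∈ Finset.Ico T (T + K), W n := Finset.sum_nonneg fun n _ ↦ hW0 n
    have hIco : ∑ n ∈ Finset.Ico T (T + (K + 1)), W n = ∑ n ∈ Finset.Ico T (T + K), W n + W (T + K) := by
      rw [show T + (K + 1) = T + K + 1 by ring, Finset.sum_Ico_succ_top (by omega)]
    rw [hIco]
    have hWK := hW0 (T + K)
    calc _ ≤ A * Real.log ((T + K : ℕ) + 2) * ∑ n ∈ Finset.Ico T (T + K), W n
          + W (T + K) * (A * Real.log ((T + K : ℕ) + 2)) := add_le_add ih' hlast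
      _ = A * Real.log ((T + K : ℕ) + 2) * (∑ n ∈ Finset.Ico T (T + K), W n + W (T + K)) := by ring
      _ ≤ A * Real.log ((T + (K + 1) : ℕ) + 2) * (∑ n ∈ Finset.Ico T (T + K), W n + W (T + K)) := by
          apply mul_le_mul_of_nonneg_right _ (by linarith)
          exact mul_le_mul_of_nonneg_left hlog hA0

/-! ## The combination -/

/-- The strip integral `∫_0^1 ∫_a^b ‖G(σ+it)‖ dt dσ` is additive over adjacent unit windows:
`∑_{T ≤ n < T+K} ∫_0^1 ∫_n^{n+1} = ∫_0^1 ∫_T^{T+K}` for continuous `G`. [folklore] -/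
theorem sum_strip_integral_eq {G : ℂ → ℂ} (hG : Continuous G) (T K : ℕ) :
    ∑ n ∈ Finset.Ico T (T + K), ∫ σ in (0 : ℝ)..1, ∫ t in (n : ℝ)..((n : ℝ) + 1), ‖G (σ + t * I)‖
      = ∫ σ in (0 : ℝ)..1, ∫ t in (T : ℝ)..((T + K : ℕ) : ℝ), ‖G (σ + t * I)‖ := by
  have hcont : ∀ a b : ℝ, Continuous fun σ : ℝ ↦ ∫ t in a..b, ‖G (σ + t * I)‖ := fun a b ↦
    intervalIntegral.continuous_parametric_intervalIntegral_of_continuous' (by fun_prop) _ _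
  rw [← intervalIntegral.integral_finsetSum fun n _ ↦ (hcont _ _).intervalIntegrable _ _]
  refine intervalIntegral.integral_congr fun σ _ ↦ ?_
  have h := intervalIntegral.sum_integral_adjacent_intervals_Ico (a := fun k : ℕ ↦ (k : ℝ))
    (f := fun t : ℝ ↦ ‖G (σ + t * I)‖) (μ := volume) (Nat.le_add_right T K)
    fun k _ ↦ ((hG.comp (by fun_prop)).norm).intervalIntegrable _ _
  simp only [Nat.cast_add, Nat.cast_one] at h
  simpa using h

/-- **Sum over zeros of an analytic function via strip mean values**: if `F` is entire with
`F' = F₁`, `F₁' = F₂` (`F₂` continuous) and `N(a+1) - N(a) ≤ A log(a+2)` for `a ≥ 0`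
(`A ≥ 0`), then for natural `T, K`
`∑_{T < Im ρ ≤ T+K} m(ρ) ‖F(ρ)‖ ≤ A log(T+K+2) (I(F) + 2 I(F₁) + I(F₂))`,
`I(G) = ∫_0^1 ∫_T^{T+K} ‖G(σ+it)‖ dt dσ` (zeros with multiplicity, any real part in `[0,1]`).
[cite: Ivic1985, (5.15)–(5.16)] -/
theorem sum_zerosBetween_norm_le_strip_integral {F F₁ F₂ : ℂ → ℂ}
    (hF : ∀ s, HasDerivAt F (F₁ s) s) (hF₁ : ∀ s, HasDerivAt F₁ (F₂ s) s) (hF₂ : Continuous F₂)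
    {A : ℝ} (hA0 : 0 ≤ A)
    (hA : ∀ a : ℝ, 0 ≤ a → (zetaZeroCount (a + 1) : ℝ) - zetaZeroCount a ≤ A * Real.log (a + 2))
    (T K : ℕ) :
    ∑ ρ ∈ SchoenfeldBound.zerosBetween (T : ℝ) ((T + K : ℕ) : ℝ),
        (riemannZetaZeroOrder ρ : ℝ) * ‖F ρ‖
      ≤ A * Real.log ((T + K : ℕ) + 2) *
        ((∫ σ in (0 : ℝ)..1, ∫ t in (T : ℝ)..((T + K : ℕ) : ℝ), ‖F (σ + t * I)‖)
          + 2 * (∫ σ in (0 : ℝ)..1, ∫ t in (T : ℝ)..((T + K : ℕ) : ℝ), ‖F₁ (σ + t * I)‖)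
          + ∫ σ in (0 : ℝ)..1, ∫ t in (T : ℝ)..((T + K : ℕ) : ℝ), ‖F₂ (σ + t * I)‖) := by
  have hFc : Continuous F := continuous_iff_continuousAt.2 fun s ↦ (hF s).continuousAt
  have hF₁c : Continuous F₁ := continuous_iff_continuousAt.2 fun s ↦ (hF₁ s).continuousAt
  set W : ℕ → ℝ := fun n ↦
    (∫ σ in (0 : ℝ)..1, ∫ t in (n : ℝ)..((n : ℝ) + 1), ‖F (σ + t * I)‖)
      + 2 * (∫ σ in (0 : ℝ)..1, ∫ t in (n : ℝ)..((n : ℝ) + 1), ‖F₁ (σ + t * I)‖)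
      + ∫ σ in (0 : ℝ)..1, ∫ t in (n : ℝ)..((n : ℝ) + 1), ‖F₂ (σ + t * I)‖ with hW
  have hnn : ∀ (G : ℂ → ℂ) (n : ℕ),
      0 ≤ ∫ σ in (0 : ℝ)..1, ∫ t in (n : ℝ)..((n : ℝ) + 1), ‖G (σ + t * I)‖ := fun G n ↦
    intervalIntegral.integral_nonneg zero_le_one fun σ _ ↦
      intervalIntegral.integral_nonneg (by linarith) fun t _ ↦ norm_nonneg _
  have hW0 : ∀ n, 0 ≤ W n := fun n ↦ by
    have := hnn F n; have := hnn F₁ n; have := hnn F₂ n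
    simp only [hW]; linarith
  have hφ : ∀ n ∈ Finset.Ico T (T + K),
      ∀ ρ ∈ SchoenfeldBound.zerosBetween (n : ℝ) ((n : ℝ) + 1), ‖F ρ‖ ≤ W n := by
    intro n _ ρ hρ
    obtain ⟨-, h1, h2, h3, h4⟩ := (SchoenfeldBound.mem_zerosBetween (Nat.cast_nonneg n)).1 hρ
    exact norm_le_strip_integral hF hF₁ hF₂ h1 h2 h3.le h4
  have h := sum_zerosBetween_windows_le (φ := fun ρ ↦ ‖F ρ‖) hW0 hA0 hA K hφ
  refine h.trans (le_of_eq ?_)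
  congr 1
  simp only [hW, Finset.sum_add_distrib, ← Finset.mul_sum]
  rw [sum_strip_integral_eq hFc, sum_strip_integral_eq hF₁c, sum_strip_integral_eq hF₂]

end Literature.NumberTheory.LFunctions
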